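import Summits.QuantumFields.BalabanUV.T4Continuum.Support.NE7BalabanGaugeTransport
import Summits.QuantumFields.BalabanUV.T4Continuum.Spine.NE3.PairLandauB8
import HarnessLib

/-!
# NE7LandauB8GaugeTransportRows — THE GAUGE-TRANSPORT LETTER (KL-T) FOR [B9]'s OWN GAUGE `R(U)` (3.21) = row NE3's `IsLandauB8` ([B8] (1.38): the field is
# `hsR`-orthogonal to `gaugeDir W (Δ_W ν)` for every block-mean-zero gauge `ν ∈ N(Q′(W))` — `R(U)` projects onto `Δ_U N(Q′(U))`, NE9's `RofUk`) FROM TWO SCALAR SUP ROWS: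
# (R-H8) the (1.38)-harmonic extension of prescribed nested block means, (R-C8) the (1.38)-Landau correction (existence = row NE3's `LandauProjectionB8.exists_landauB8_correction`);
# `λ = σ + h + c`, `C_R = 6dC_H·M`, `C_Ξ = 1 + C_H`, `C_D = C_b` — the twin of F174 for the gauge NE9's rows are typed in (file 107 of the curved (APE), F177)

Cell `pub-balaban`, rung (B)+1 sub-cell t4, lineage `b2b-balaban-t4-ne7-p1` (CRUX PROVER NE7 #1 = OWNER of row NE7), generation 83; memo
`t4/b2b-balaban-t4-ne7-p1-g83/BALABAN-GAUGE-ROAD.md` §8.  Twin of F174 `NE7BalabanGaugeTransportRows` with the test directions `gaugeDir W (covLapSite W ν)` of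
`Spine/NE3/PairLandauB8.IsLandauB8` in place of `gaugeDir W ν`.
WHY.  NE9's soft operator `laplaceAk = hessOp + D·RofUk·D^* + QkW^*·a·QkW` ([B9] (3.26)) fixes the gauge with `RofUk` = the orthogonal projection onto `Δ_U N(Q′(U))` ((3.21)–(3.23)
p. 394): the condition «`R(U) D^*X = 0`» is `D^*X ⊥ Δ_U N(Q′)`, i.e. `X ⊥ D_U Δ_U N(Q′)` — LITERALLY row NE3's `IsLandauB8 L N (j+1) W X` (the linearised [B8] (1.38) gauge, in which
E′'s representative already lives up to its defect `b₀`).  So the `Gauge` under which (KL-B) is NE9's row is `IsLandauB8`, and the transport must land there: this file.  The plain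
block-Landau variant (F174∕F175) stays valid for a bootstrap that fixes the gauge locally.
WHAT ([folklore]; 0 def, 0 sorry).  **`transportLetter_landauB8_of_rows`** (`d ≥ 1`, `L ≥ 2`, `curvSum ≤ 2L∕3`): (KL-T) of F167∕F169 at `Gauge := IsLandauB8 L N (j+1) W` with
`C_R = 6dC_H·L^{j+1}`, `C_Ξ = 1 + C_H`, `C_D = C_b`, from (R-H8) + (R-C8).
HONEST FRAMING (page 1): kinematics∕bookkeeping; (R-H8) and the SIZE in (R-C8) are DISPLAYED HYPOTHESES (scalar sup rows of [B8]∕[B9]'s gauge-fixing operators at curved `W`,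
NOT proved; (R-C8)'s existence is row NE3's; its sup letters in the Spine (`LandauCorrectionSupB8*`) are for a special class of fields and carry the volume factor — not (R-C8));
nothing of Bałaban's asserted; (APE) on curved data NOT proved; NOT ONE-STEP, NOT NE7; spine 0∕9; finite T⁴ rung (B)+1 — NOT infinite volume, NOT mass gap, NOT `BetaPertH`,
NOT Clay.  Continuum YM on T⁴ ⇐ BetaPertH ∧ nine spine estimates (0/9 proved); BetaPertH ⇐ (D1) ∧ (D4) ∧ CAP+tail; G-an2-4 gates asym, D1 and NE2/3/4.
-/

set_option autoImplicit false

open scoped BigOperators Matrix Matrix.Norms.L2Operator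
open NormedSpace Finset

namespace Summit.QuantumFields.BalabanUV.T4Continuum.NE7LandauB8GaugeTransportRows

open Literature.MathematicalPhysics.QuantumFieldTheory.Balaban1983to89
open B7Prop1Explicit B7Prop2Explicit UnitaryModel
open T4AveragingDeficitWall (Ad IsUnitaryCfg IsSkewDir SmallField curlAt dirL1)
open T4AveragingDeficitWallBoundary (IsPeriodicCfg periodBox)
open AveragingDeficitPeriodicCounting (IsPeriodicDir)
open AveragingDeficitMultiLevelPrep (cavgIter tower LevelSmall)
open BlockAveragePushDirGauge (gaugeDir)
open NE3CovariantCalculus (hsR hsR_add_left)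
open NE3TangentCovariantTower (dirIter QbarIter framePotW)
open NE3TangentCovariantStructure (gaugeDir_add_fun)
open NE3CovariantWeitzenbock (covDiv)
open NE3CovariantBlockMean (bmeanIterW bmeanIterW_skew_periodic)
open NE3FrameFreeSliceW (bmeanIterW_add)
open NE3CurvedFrameKill (framePotW_skew_periodic)
open NE3FramePotBoundW (tower_eq_pow_mul)
open NE3CovariantLineSumsTower (QbarIter_add)
open NE3ExactLineSumsTower (norm_bmeanIterW_le_of_sup)
open NE3LinearisedAverageSup (curvSum norm_framePotW_le_sup)
open NE7BalabanGaugeTransport (QbarIter_gaugeDir_eq_bmean QbarIter_eq_neg_frame_of_tangent)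
open NE3.PairLandauB8 (avgKernelGauges mem_avgKernelGauges_iff covLapSite IsLandauB8)

noncomputable section

variable {d : ℕ} {n : Type*} [Fintype n] [DecidableEq n]

/-- **(KL-T) FOR [B9]'s `R(U)`-GAUGE (= `IsLandauB8`) FROM THE TWO SCALAR ROWS (R-H8) + (R-C8).**  As F174's `transportLetter_blockLandau_of_rows` with the test directions
`gaugeDir W (covLapSite W ν)`, `ν ∈ N(Q′(W))`: (R-H8) a skew periodic `h` with `bmeanIterW h = θ′`, `IsLandauB8 L N (j+1) W (gaugeDir W h)`, `‖h‖_∞ ≤ C_H·s`; (R-C8) a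
`c ∈ N(Q′(W))` with `IsLandauB8 L N (j+1) W (Z + gaugeDir W c)` and `‖c‖_∞ ≤ C_b·‖covDiv_W Z‖_∞`-bound; then `λ = σ + h + c` moves every contour-tangent `X` onto `ker QbarIter_W`
and into `IsLandauB8`, `‖λ‖_∞ ≤ (6dC_H·L^{j+1})·R + (1 + C_H)·Ξ + C_b·D`. [folklore] -/
theorem transportLetter_landauB8_of_rows [Nonempty n] (hd : 1 ≤ d) {L N : ℕ} [NeZero N] (hL : 2 ≤ L) (j : ℕ)
    {W : Site d → Fin d → (Matrix n n ℂ)ˣ} {x : ℝ} (hWu : IsUnitaryCfg W) (hWP : IsPeriodicCfg W ((N * L ^ (j + 1) : ℕ) : ℤ))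
    (hx : 0 ≤ x) (hs : LevelSmall d L j x) (hWx : SmallField W x) (hA : curvSum d L (j + 1) x ≤ 2 / 3 * L)
    {CH Cb : ℝ}
    (hRH : ∀ θ' : Site d → Matrix n n ℂ, (∀ z, θ' z ∈ skewAdjoint (Matrix n n ℂ)) → (∀ (z : Site d) (i : Fin d), θ' (z + (N : ℤ) • e i) = θ' z) →
      ∀ s : ℝ, (∀ z, ‖θ' z‖ ≤ s) →
      ∃ h : Site d → Matrix n n ℂ, (∀ y, h y ∈ skewAdjoint (Matrix n n ℂ)) ∧
        (∀ (y : Site d) (i : Fin d), h (y + ((N * L ^ (j + 1) : ℕ) : ℤ) • e i) = h y) ∧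
        bmeanIterW L (j + 1) W h = θ' ∧
        IsLandauB8 (d := d) L N (j + 1) W (gaugeDir W h) ∧
        (∀ y, ‖h y‖ ≤ CH * s))
    (hRC : ∀ Z : Site d → Fin d → Matrix n n ℂ, IsSkewDir Z → IsPeriodicDir Z ((N * L ^ (j + 1) : ℕ) : ℤ) →
      ∀ D' : ℝ, (∀ y, ‖covDiv W Z y‖ ≤ D') →
      ∃ c ∈ avgKernelGauges (d := d) (n := n) L N (j + 1) W,
        IsLandauB8 (d := d) L N (j + 1) W (fun y κ => Z y κ + gaugeDir W c y κ) ∧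
        ∀ y, ‖c y‖ ≤ Cb * D') :
    ∀ X : Site d → Fin d → Matrix n n ℂ, IsSkewDir X → IsPeriodicDir X ((N * L ^ (j + 1) : ℕ) : ℤ) → dirIter L (j + 1) W X = 0 →
      ∀ σ : Site d → Matrix n n ℂ, (∀ y, σ y ∈ skewAdjoint (Matrix n n ℂ)) → (∀ (y : Site d) (i : Fin d), σ (y + ((N * L ^ (j + 1) : ℕ) : ℤ) • e i) = σ y) →
      ∀ R : ℝ, (∀ y κ', ‖X y κ'‖ ≤ R) → ∀ Ξ : ℝ, (∀ y, ‖σ y‖ ≤ Ξ) →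
      ∀ D : ℝ, (∀ y, ‖covDiv W (fun z κ => X z κ + gaugeDir W σ z κ) y‖ ≤ D) →
      ∃ lam : Site d → Matrix n n ℂ, (∀ y, lam y ∈ skewAdjoint (Matrix n n ℂ)) ∧
        (∀ (y : Site d) (i : Fin d), lam (y + ((N * L ^ (j + 1) : ℕ) : ℤ) • e i) = lam y) ∧
        QbarIter L (j + 1) W (fun y κ => X y κ + gaugeDir W lam y κ) = 0 ∧
        IsLandauB8 (d := d) L N (j + 1) W (fun y κ => X y κ + gaugeDir W lam y κ) ∧
        ∀ y, ‖lam y‖ ≤ (CH * (6 * (d : ℝ) * (L : ℝ) ^ (j + 1))) * R + (1 + CH) * Ξ + Cb * D := by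
  intro X hXs hXP hXT σ hσs hσP R hR Ξ hσΞ D hD
  have hL1 : 1 ≤ L := by omega
  have htow : (tower L N (j + 1) : ℕ) = N * L ^ (j + 1) := by rw [tower_eq_pow_mul, Nat.mul_comm]
  have hWP' : IsPeriodicCfg W ((tower L N (j + 1) : ℕ) : ℤ) := by rw [htow]; exact hWP
  have hXP' : IsPeriodicDir X ((tower L N (j + 1) : ℕ) : ℤ) := by rw [htow]; exact hXP
  have hσP' : ∀ (y : Site d) (i : Fin d), σ (y + ((tower L N (j + 1) : ℕ) : ℤ) • e i) = σ y := by rw [htow]; exact hσP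
  have hR0 : 0 ≤ R := (norm_nonneg _).trans (hR 0 ⟨0, by omega⟩)
  -- the accumulated frames `θ` of `X` and the block means `θσ` of `σ`
  obtain ⟨hθs, hθP⟩ := framePotW_skew_periodic hL1 j hWu hWP' hx hs hWx hXs hXP'
  obtain ⟨hθσs, hθσP⟩ := bmeanIterW_skew_periodic hL1 j hWu hWP' hx hs hWx hσs hσP'
  set θ : Site d → Matrix n n ℂ := framePotW L (j + 1) W X with hθdef
  set θσ : Site d → Matrix n n ℂ := bmeanIterW L (j + 1) W σ with hθσdef
  have hθb : ∀ z, ‖θ z‖ ≤ 6 * (d : ℝ) * (L : ℝ) ^ (j + 1) * R := fun z => norm_framePotW_le_sup hL j hWu hx hs hWx hR0 hR hA z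
  have hθσb : ∀ z, ‖θσ z‖ ≤ Ξ := fun z => norm_bmeanIterW_le_of_sup hL1 j hWu hx hs hWx hσΞ z
  -- (R-H) on `θ′ = θ − θσ`
  set s : ℝ := 6 * (d : ℝ) * (L : ℝ) ^ (j + 1) * R + Ξ with hsdef
  obtain ⟨h, hhs, hhP, hhm, hhL, hhb⟩ := hRH (fun z => θ z - θσ z)
    (fun z => (skewAdjoint (Matrix n n ℂ)).sub_mem (hθs z) (hθσs z)) (fun z i => by simp only [hθP z i, hθσP z i]) s
    (fun z => (norm_sub_le _ _).trans (by rw [hsdef]; exact add_le_add (hθb z) (hθσb z)))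
  have hhP' : ∀ (y : Site d) (i : Fin d), h (y + ((tower L N (j + 1) : ℕ) : ℤ) • e i) = h y := by rw [htow]; exact hhP
  -- (R-C) on the END's own field `Z = X + gaugeDir W σ`
  set Z : Site d → Fin d → Matrix n n ℂ := fun y κ => X y κ + gaugeDir W σ y κ with hZdef
  have hZs : IsSkewDir Z := NE7SliceLetterBalabanGauge.isSkewDir_add hXs (NE7ExactCurrent.isSkewDir_gaugeDir hWu hσs)
  have hZP : IsPeriodicDir Z ((N * L ^ (j + 1) : ℕ) : ℤ) :=
    NE7SliceLetterBalabanGauge.isPeriodicDir_add' hXP (BlockAveragePushDirGauge.isPeriodicDir_gaugeDir hWP hσP)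
  obtain ⟨c, hc, hcL, hcb⟩ := hRC Z hZs hZP D hD
  obtain ⟨hcs, hcP, hcm⟩ := mem_avgKernelGauges_iff.mp hc
  have hcP' : ∀ (y : Site d) (i : Fin d), c (y + ((tower L N (j + 1) : ℕ) : ℤ) • e i) = c y := by rw [htow]; exact hcP
  -- the total gauge parameter `λ = σ + h + c`
  set lam : Site d → Matrix n n ℂ := fun y => σ y + h y + c y with hlamdef
  have hlams : ∀ y, lam y ∈ skewAdjoint (Matrix n n ℂ) := fun y =>
    (skewAdjoint (Matrix n n ℂ)).add_mem ((skewAdjoint (Matrix n n ℂ)).add_mem (hσs y) (hhs y)) (hcs y)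
  have hlamP : ∀ (y : Site d) (i : Fin d), lam (y + ((N * L ^ (j + 1) : ℕ) : ℤ) • e i) = lam y := fun y i => by
    simp only [hlamdef, hσP y i, hhP y i, hcP y i]
  have hlamP' : ∀ (y : Site d) (i : Fin d), lam (y + ((tower L N (j + 1) : ℕ) : ℤ) • e i) = lam y := by rw [htow]; exact hlamP
  have hblam : bmeanIterW L (j + 1) W lam = θ := by
    have h1 : lam = (σ + h) + c := by funext y; simp [hlamdef]
    rw [h1, bmeanIterW_add, bmeanIterW_add, hhm, hcm]
    funext z
    simp only [Pi.add_apply, Pi.zero_apply, hθσdef]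
    abel
  -- pointwise splitting of the moved field: `X + D_Wλ = (Z + D_W c) + D_W h`
  have hsplit : ∀ (y : Site d) (κ : Fin d), X y κ + gaugeDir W lam y κ = (Z y κ + gaugeDir W c y κ) + gaugeDir W h y κ := by
    intro y κ
    have h1 : gaugeDir W lam y κ = gaugeDir W σ y κ + gaugeDir W h y κ + gaugeDir W c y κ := by
      rw [hlamdef, gaugeDir_add_fun, gaugeDir_add_fun]
    rw [h1]
    simp only [hZdef]
    abel
  refine ⟨lam, hlams, hlamP, ?_, ?_, ?_⟩
  · -- straight-tangency: the block means of `λ` are exactly the accumulated frames of `X`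
    rw [QbarIter_add hL1 j hWu hx hs hWx X (gaugeDir W lam), QbarIter_eq_neg_frame_of_tangent hL1 j hWu hWP' hx hs hWx hXs hXP' hXT,
      QbarIter_gaugeDir_eq_bmean hL1 j hWu hWP' hx hs hWx hlams hlamP', hblam]
    funext z κ
    simp only [Pi.zero_apply]
    exact neg_add_cancel _
  · -- the (1.38)-Landau condition: (R-C8)'s for `Z + D_W c` plus (R-H8)'s for `D_W h`
    intro nu hnu
    have h1 := hcL nu hnu
    have h2 := hhL nu hnu
    calc ∑ y ∈ periodBox (d := d) (N * L ^ (j + 1)), ∑ κ : Fin d, hsR (X y κ + gaugeDir W lam y κ) (gaugeDir W (covLapSite W nu) y κ)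
        = ∑ y ∈ periodBox (d := d) (N * L ^ (j + 1)), ∑ κ : Fin d,
            (hsR (Z y κ + gaugeDir W c y κ) (gaugeDir W (covLapSite W nu) y κ) + hsR (gaugeDir W h y κ) (gaugeDir W (covLapSite W nu) y κ)) := by
          refine Finset.sum_congr rfl fun y _ => Finset.sum_congr rfl fun κ _ => ?_
          rw [hsplit, hsR_add_left]
      _ = 0 := by rw [Finset.sum_comm]; simp only [Finset.sum_add_distrib]; rw [Finset.sum_comm, h1, Finset.sum_comm, h2, add_zero]
  · -- the size
    intro y
    calc ‖lam y‖ = ‖σ y + h y + c y‖ := rfl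
      _ ≤ ‖σ y‖ + ‖h y‖ + ‖c y‖ := (norm_add_le _ _).trans (by gcongr; exact norm_add_le _ _)
      _ ≤ Ξ + CH * s + Cb * D := add_le_add (add_le_add (hσΞ y) (hhb y)) (hcb y)
      _ = (CH * (6 * (d : ℝ) * (L : ℝ) ^ (j + 1))) * R + (1 + CH) * Ξ + Cb * D := by rw [hsdef]; ring

end

end Summit.QuantumFields.BalabanUV.T4Continuum.NE7LandauB8GaugeTransportRows
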